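import Literature.NumberTheory.DiophantineGeometry.CatalanTheoremIII
import Literature.NumberTheory.DiophantineGeometry.CatalanNagell
import Literature.NumberTheory.DiophantineGeometry.CatalanTheoremI
import HarnessLib

/-!
# Mihăilescu's Theorem III for all odd primes, and Catalan's conjecture from Theorem II alone

[Schoof2009, Theorem III] (P. Mihăilescu 2003): *for odd primes `p, q` and non-zero integers `x, y`
with `x ^ p - y ^ q = 1` one has `p < 4q²` and `q < 4p²`.* The tree proves the main case
`p, q ≥ 5`, `q > 4p² ⟹ False` (`Catalan.not_four_mul_sq_lt`, the minus argument of
[Schoof2009, Chapter 11], file `CatalanTheoremIII`) and, for the prime `3`, that there is no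
solution at all (Nagell's theorem = [Schoof2009, Theorem IV] for `3`, `Catalan.Nagell.five_le`, file
`CatalanNagell`). This file assembles them:

* `Catalan.theoremIII` — **Theorem III** exactly in the form `hIII` consumed by
  `Catalan.mihailescu_of_theorems_II_III` (`CatalanTheoremI`);
* `Catalan.mihailescu_of_theoremII` — **Catalan's conjecture
  (`Literature.NumberTheory.DiophantineGeometry.mihailescu`) now follows from Mihăilescu's
  Theorem II alone** (`p ≡ 1 (mod q)` or `q ≡ 1 (mod p)`; [Mihailescu2004],
  [Schoof2009, Chapters 12, 14, 16]): Theorems I and III and the classical cases are proved in the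
  tree.

Everything is proved; no definitions, no named facts.

## References

* R. Schoof, *Catalan's Conjecture*, Universitext, Springer 2009 [Schoof2009], Theorem III (p. 4),
  Chapter 11 (p. 80: "By Theorem IV, we may assume `p, q ≥ 5` … by symmetry `q > 4p²`"), Theorem IV.
* P. Mihăilescu, *Primary cyclotomic units and a proof of Catalan's conjecture*, J. reine angew.
  Math. **572** (2004), 167–195 [Mihailescu2004].
-/

namespace Literature.NumberTheory.DiophantineGeometry

namespace Catalan

/-- **Mihăilescu's Theorem III** [Schoof2009, Theorem III]: for odd primes `p, q` and non-zero
integers with `x ^ p - y ^ q = 1`, `p < 4q²` and `q < 4p²`. (For `p, q ≥ 5` this is the minus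
argument `Catalan.not_four_mul_sq_lt`, applied to `(x, y, p, q)` and to `(-y, -x, q, p)`; the
prime `3` does not occur by Nagell's theorem `Catalan.Nagell.five_le`; `q = 4p²` is not prime.)
[cite: Schoof2009, Theorem III (Ch. 1 p. 4; proof Ch. 11 p. 80)] -/
theorem theoremIII {p q : ℕ} {x y : ℤ} (hp : p.Prime) (hq : q.Prime) (hpo : Odd p) (hqo : Odd q)
    (hx : x ≠ 0) (hy : y ≠ 0) (h : x ^ p - y ^ q = 1) : p < 4 * q ^ 2 ∧ q < 4 * p ^ 2 := by
  obtain ⟨hp5, hq5⟩ := Nagell.five_le hp hq hpo hqo hx hy h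
  -- the mirrored solution `(-y)^q - (-x)^p = 1`
  have h' : (-y) ^ q - (-x) ^ p = 1 := by rw [hqo.neg_pow, hpo.neg_pow]; linarith
  -- `4 a² ` is never a prime
  have hne : ∀ {a b : ℕ}, b.Prime → b ≠ 4 * a ^ 2 := by
    intro a b hb hab
    have h2 : 2 ∣ b := ⟨2 * a ^ 2, by rw [hab]; ring⟩
    rcases hb.eq_one_or_self_of_dvd 2 h2 with h22 | h22
    · omega
    · rw [← h22] at hab
      have : a ^ 2 ≤ 1 := by omega
      rcases Nat.le_one_iff_eq_zero_or_eq_one.mp this with h0 | h1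
      · rw [h0] at hab; omega
      · rw [h1] at hab; omega
  constructor
  · by_contra hle
    have hlt : 4 * q ^ 2 < p := lt_of_le_of_ne (not_lt.mp hle) (fun h0 => hne hp h0.symm)
    haveI := Fact.mk hq
    exact not_four_mul_sq_lt (p := q) (q := p) hp hq5 hp5 hlt (neg_ne_zero.mpr hy)
      (neg_ne_zero.mpr hx) h'
  · by_contra hle
    have hlt : 4 * p ^ 2 < q := lt_of_le_of_ne (not_lt.mp hle) (fun h0 => hne hq h0.symm)
    haveI := Fact.mk hp
    exact not_four_mul_sq_lt hq hp5 hq5 hlt hx hy h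

/-- **Catalan's conjecture from Mihăilescu's Theorem II.** With Theorem I (`Catalan.theoremI`),
Theorem III (`Catalan.theoremIII`) and the classical cases proved in the tree,
`Literature.NumberTheory.DiophantineGeometry.mihailescu` (Mihăilescu's theorem: the only solution of
`x^a - y^b = 1` in integers `a, b ≥ 2`, `x, y ≥ 1` is `3² - 2³ = 1`) follows from Theorem II alone
([Mihailescu2004]; [Schoof2009, Theorem II, Chapters 12, 14, 16]).
[cite: Schoof2009, Ch. 1, Main theorem (proof, pp. 4–5)] -/
theorem mihailescu_of_theoremII
    (hII : ∀ {p q : ℕ} {x y : ℤ}, p.Prime → q.Prime → Odd p → Odd q → x ≠ 0 → y ≠ 0 →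
      x ^ p - y ^ q = 1 → p ≡ 1 [MOD q] ∨ q ≡ 1 [MOD p]) :
    mihailescu :=
  mihailescu_of_theorems_II_III hII
    (fun hp hq hpo hqo hx hy h => theoremIII hp hq hpo hqo hx hy h)

end Catalan

end Literature.NumberTheory.DiophantineGeometry
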